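import Summits.AtomisticToContinuum.BoseEinsteinCondensation.Theorems.BECGroundStateSOSPeriodicIRBoundWFDefs
import Summits.AtomisticToContinuum.BoseEinsteinCondensation.Theorems.BECGroundStateSOSPeriodicIRBoundWFFormBounds
import Summits.AtomisticToContinuum.BoseEinsteinCondensation.Theorems.BECGroundStateSOSPeriodicIRBoundWFPotCross
import Summits.AtomisticToContinuum.BoseEinsteinCondensation.Theorems.PuffFloor.Negative.CorePairDominationConstState
import Literature.MathematicalPhysics.QuantumManyBody.PeriodicBoseGas
import HarnessLib

/-!
# Crux `PeriodicIRBound` (stmt-AtomisticToContinuum-3972), line `fsum-phase-pencil`, stub S5-C1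
# `stub_fsumPathTransport` — continuity of the periodic variational problem along the coupling path `t ↦ t·w`

At fixed particle number `N` and side `L > 0`, for a measurable profile `w` with `w(|·|) ∈ L¹(ℝ³)` and the
coupling family `w_t = t·w` (`t ∈ [0,1]`, entered as `r ↦ ENNReal.ofReal t * w r`), near-minimisers of the periodic
`N`-body energy `E_{t'} = ⟨·, (-∑Δ + t' ∑ w^per) ·⟩` are near-minimisers of `E_t` once `t'` is close to `t`:
`∀ ε > 0 ∃ θ > 0 ∃ δ' > 0`, `|t' - t| < θ` and `E_{t'}[Ψ] ≤ E₀(t') + δ'` imply `E_t[Ψ] ≤ E₀(t) + ε`.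

Proof (elementary, all in `ℝ≥0∞`).
* (a) The energy is affine along the path: `E_t[Ψ] = T[Ψ] + t·P_w[Ψ]` with the kinetic energy `T` and the
  potential form `P_w[Ψ] = ∫ (∑_{i<j} w^per)|Ψ|²` (`periodicEnergy_couplingPath`); hence `t ↦ E_t[Ψ]` and
  `t ↦ E₀(t)` are monotone and `E_t[Ψ] ≤ E_{t'}[Ψ] + |t - t'|·P_w[Ψ]`.
* (b) Hartree bound: the constant state has no kinetic energy, so `E₀(t) ≤ t·H` with the finite constant
  `H = P_w[Ψ_const] = (L³)^{-N} ∫_{cell^N} ∑_{i<j} w^per` (`lintegral_cellN_periodicInteraction_ne_top`).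
* (c) `P_w` of a `δ`-near-minimiser at coupling `t > 0` is at most `H + δ/t`.
* (d) `t = 0`: `E_0[Ψ] = T[Ψ] ≤ E_{t'}[Ψ] ≤ t'·H + δ'`, small for `t' < θ`.
* (e) `t > 0`, `θ ≤ t/2`: if `t ≤ t'`, transport an `ε/3`-near-minimiser `Φ` of `E_t` to `t'`
  (`E₀(t') ≤ E_t[Φ] + θ·P_w[Φ]`) and use monotonicity `E_t[Ψ] ≤ E_{t'}[Ψ]`; if `t' < t`, transport `Ψ` itself
  (`E_t[Ψ] ≤ E_{t'}[Ψ] + θ·P_w[Ψ]`, `P_w[Ψ] ≤ H + 2δ'/t` by (c) as `t' ≥ t/2`) and use `E₀(t') ≤ E₀(t)`.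

Registered helper stub `stub_fsumPathTransport` (consumed by `stub_fsumCouplingSelect`).
-/

noncomputable section

open MeasureTheory Filter
open scoped ENNReal NNReal ComplexConjugate BigOperators

namespace Summit.AtomisticToContinuum.BoseEinsteinCondensation.Cruxes.PeriodicIRBound.FsumPhasePencil

open Literature.MathematicalPhysics.QuantumManyBody.BoseGas
open Summit.AtomisticToContinuum.BoseEinsteinCondensation.Cruxes.PeriodicIRBound.LinearPhFloorWagner.WF
open Summit.AtomisticToContinuum.BoseEinsteinCondensation.Theorems.PuffFloor.Negative
  (constState constAmp kineticDensity_const pairExpectation_constState)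

variable {N : ℕ} {L : ℝ}

section PathTransport

/-! ## (a) The energy is affine along the coupling path -/

/-- Homogeneity of the periodic interaction in the coupling: `∑_{i<j} (t·w)^per = t · ∑_{i<j} w^per`. [folklore] -/
theorem periodicInteraction_couplingPath (t : ℝ) (w : ℝ → ℝ≥0∞) (L : ℝ) (X : Config N) :
    periodicInteraction (fun r => ENNReal.ofReal t * w r) L X = ENNReal.ofReal t * periodicInteraction w L X := by
  simp only [periodicInteraction, periodizedPotential, ENNReal.tsum_mul_left, Finset.mul_sum]

/-- Homogeneity of the potential form in the coupling: `P_{t·w}[f] = t · P_w[f]`. [folklore] -/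
theorem potForm_couplingPath (t : ℝ) (w : ℝ → ℝ≥0∞) (L : ℝ) (f : Config N → ℂ) :
    potForm (fun r => ENNReal.ofReal t * w r) L f = ENNReal.ofReal t * potForm w L f := by
  unfold potForm
  simp only [periodicInteraction_couplingPath, mul_assoc]
  exact lintegral_const_mul' _ _ ENNReal.ofReal_ne_top

/-- **The energy is affine along the coupling path**: `E_{t·w}[Ψ] = T[Ψ] + t · P_w[Ψ]`. [folklore] -/
theorem periodicEnergy_couplingPath (t : ℝ) (w : ℝ → ℝ≥0∞) (Ψ : PeriodicTrialState N L) :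
    periodicEnergy (fun r => ENNReal.ofReal t * w r) Ψ =
      (∫⁻ X in cellN N L, kineticDensity Ψ.ψ X) + ENNReal.ofReal t * potForm w L Ψ.ψ := by
  rw [periodicEnergy_eq_qform, qform_eq_lintegral_kineticDensity_add_potForm, potForm_couplingPath]

/-- The energy of a fixed trial state is monotone along the coupling path. [folklore] -/
theorem periodicEnergy_couplingPath_mono {s t : ℝ} (hst : s ≤ t) (w : ℝ → ℝ≥0∞) (Ψ : PeriodicTrialState N L) :
    periodicEnergy (fun r => ENNReal.ofReal s * w r) Ψ ≤ periodicEnergy (fun r => ENNReal.ofReal t * w r) Ψ := by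
  rw [periodicEnergy_couplingPath, periodicEnergy_couplingPath]
  gcongr

/-- The ground-state energy is monotone along the coupling path. [folklore] -/
theorem periodicGroundStateEnergy_couplingPath_mono {s t : ℝ} (hst : s ≤ t) (w : ℝ → ℝ≥0∞) (N : ℕ) (L : ℝ) :
    periodicGroundStateEnergy (fun r => ENNReal.ofReal s * w r) N L ≤
      periodicGroundStateEnergy (fun r => ENNReal.ofReal t * w r) N L :=
  iInf_mono fun Ψ => periodicEnergy_couplingPath_mono hst w Ψ

/-- **Transport along the path**: `E_t[Ψ] ≤ E_{t'}[Ψ] + |t - t'| · P_w[Ψ]`. [folklore] -/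
theorem periodicEnergy_couplingPath_le_add (t t' : ℝ) (w : ℝ → ℝ≥0∞) (Ψ : PeriodicTrialState N L) :
    periodicEnergy (fun r => ENNReal.ofReal t * w r) Ψ ≤
      periodicEnergy (fun r => ENNReal.ofReal t' * w r) Ψ + ENNReal.ofReal |t - t'| * potForm w L Ψ.ψ := by
  rw [periodicEnergy_couplingPath, periodicEnergy_couplingPath]
  have hst : ENNReal.ofReal t ≤ ENNReal.ofReal t' + ENNReal.ofReal |t - t'| := by
    calc ENNReal.ofReal t ≤ ENNReal.ofReal (t' + |t - t'|) :=
          ENNReal.ofReal_le_ofReal (by linarith [le_abs_self (t - t')])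
      _ ≤ ENNReal.ofReal t' + ENNReal.ofReal |t - t'| := ENNReal.ofReal_add_le
  calc (∫⁻ X in cellN N L, kineticDensity Ψ.ψ X) + ENNReal.ofReal t * potForm w L Ψ.ψ
      ≤ (∫⁻ X in cellN N L, kineticDensity Ψ.ψ X) +
          (ENNReal.ofReal t' + ENNReal.ofReal |t - t'|) * potForm w L Ψ.ψ := by gcongr
    _ = _ := by rw [add_mul, add_assoc]

/-- The potential part is paid by the energy: `t · P_w[Ψ] ≤ E_{t·w}[Ψ]`. [folklore] -/
theorem ofReal_mul_potForm_le_periodicEnergy (t : ℝ) (w : ℝ → ℝ≥0∞) (Ψ : PeriodicTrialState N L) :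
    ENNReal.ofReal t * potForm w L Ψ.ψ ≤ periodicEnergy (fun r => ENNReal.ofReal t * w r) Ψ := by
  rw [periodicEnergy_couplingPath]
  exact le_add_self

/-! ## (b) The Hartree bound and (c) the control of the potential part of near-minimisers -/

/-- **Hartree bound**: `E₀(t) ≤ t · P_w[Ψ_const]`, the constant state having no kinetic energy. [folklore] -/
theorem periodicGroundStateEnergy_couplingPath_le_hartree (hL : 0 < L) (t : ℝ) (w : ℝ → ℝ≥0∞) :
    periodicGroundStateEnergy (fun r => ENNReal.ofReal t * w r) N L ≤
      ENNReal.ofReal t * potForm w L (constState N hL).ψ := by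
  refine (periodicGroundStateEnergy_le _ (constState N hL)).trans (le_of_eq ?_)
  rw [periodicEnergy_couplingPath]
  have h0 : (∫⁻ X in cellN N L, kineticDensity (constState N hL).ψ X) = 0 := by
    show (∫⁻ X in cellN N L, kineticDensity (fun _ : Config N => (constAmp N L : ℂ)) X) = 0
    simp only [kineticDensity_const, lintegral_zero]
  rw [h0, zero_add]

/-- The Hartree constant `H = P_w[Ψ_const] = (L³)^{-N} ∫_{cell^N} ∑_{i<j} w^per` is finite for an integrable
profile. [folklore] -/
theorem potForm_constState_ne_top (hL : 0 < L) {w : ℝ → ℝ≥0∞} (hw : Measurable w)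
    (hint : (∫⁻ x : Space, w ‖x‖) ≠ ⊤) : potForm w L (constState N hL).ψ ≠ ⊤ := by
  unfold potForm
  rw [pairExpectation_constState w hL]
  exact ENNReal.mul_ne_top (lintegral_cellN_periodicInteraction_ne_top hL hw hint N) ENNReal.ofReal_ne_top

/-- **Potential part of a near-minimiser**: at coupling `t > 0`, `E_t[Ψ] ≤ E₀(t) + δ` gives
`P_w[Ψ] ≤ P_w[Ψ_const] + δ/t` (from `t·P_w[Ψ] ≤ E_t[Ψ]` and the Hartree bound). [folklore] -/
theorem potForm_le_of_nearMin (hL : 0 < L) {t : ℝ} (ht : 0 < t) (w : ℝ → ℝ≥0∞) {δ : ℝ≥0∞}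
    (Ψ : PeriodicTrialState N L)
    (hΨ : periodicEnergy (fun r => ENNReal.ofReal t * w r) Ψ ≤
      periodicGroundStateEnergy (fun r => ENNReal.ofReal t * w r) N L + δ) :
    potForm w L Ψ.ψ ≤ potForm w L (constState N hL).ψ + δ / ENNReal.ofReal t := by
  have ha0 : ENNReal.ofReal t ≠ 0 := (ENNReal.ofReal_pos.2 ht).ne'
  have hat : ENNReal.ofReal t ≠ ⊤ := ENNReal.ofReal_ne_top
  have h : ENNReal.ofReal t * potForm w L Ψ.ψ ≤ ENNReal.ofReal t * potForm w L (constState N hL).ψ + δ :=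
    (ofReal_mul_potForm_le_periodicEnergy t w Ψ).trans
      (hΨ.trans (add_le_add (periodicGroundStateEnergy_couplingPath_le_hartree hL t w) le_rfl))
  calc potForm w L Ψ.ψ = (ENNReal.ofReal t)⁻¹ * (ENNReal.ofReal t * potForm w L Ψ.ψ) := by
        rw [← mul_assoc, ENNReal.inv_mul_cancel ha0 hat, one_mul]
    _ ≤ (ENNReal.ofReal t)⁻¹ * (ENNReal.ofReal t * potForm w L (constState N hL).ψ + δ) := by gcongr
    _ = potForm w L (constState N hL).ψ + δ / ENNReal.ofReal t := by
        rw [mul_add, ← mul_assoc, ENNReal.inv_mul_cancel ha0 hat, one_mul, div_eq_mul_inv, mul_comm δ]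

/-! ## The path transport -/

/-- **Continuity of the periodic variational problem along the coupling path** (S5-C1): at fixed `(N, L)`, for
a measurable profile `w` with `∫ w(|x|) dx < ∞`, every `t ≥ 0` and `ε > 0` admit `θ > 0` and `δ' > 0` such that
every `δ'`-near-minimiser of `E_{t'·w}` with `t' ≥ 0`, `|t' - t| < θ` is an `ε`-near-minimiser of `E_{t·w}`.
[folklore] -/
theorem pathTransport_nearMin (hL : 0 < L) {w : ℝ → ℝ≥0∞} (hw : Measurable w)
    (hint : (∫⁻ x : Space, w ‖x‖) ≠ ⊤) {t : ℝ} (ht : 0 ≤ t) {ε : ℝ≥0∞} (hε : 0 < ε) :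
    ∃ θ : ℝ, 0 < θ ∧ ∃ δ' : ℝ≥0∞, 0 < δ' ∧ ∀ t' : ℝ, t' ∈ Set.Icc (0 : ℝ) 1 → |t' - t| < θ →
      ∀ Ψ : PeriodicTrialState N L,
        periodicEnergy (fun r => ENNReal.ofReal t' * w r) Ψ ≤
            periodicGroundStateEnergy (fun r => ENNReal.ofReal t' * w r) N L + δ' →
          periodicEnergy (fun r => ENNReal.ofReal t * w r) Ψ ≤
            periodicGroundStateEnergy (fun r => ENNReal.ofReal t * w r) N L + ε := by
  -- `ε = ⊤`: nothing to prove
  rcases eq_or_ne ε ⊤ with rfl | hεtop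
  · exact ⟨1, one_pos, 1, one_pos, fun t' _ _ Ψ _ => by rw [add_top]; exact le_top⟩
  -- the Hartree constant `H = P_w[Ψ_const] < ⊤` and the third `ε₃ = ε/3 ∈ (0, ⊤)`
  set H : ℝ≥0∞ := potForm w L (constState N hL).ψ with hHdef
  have hH : H ≠ ⊤ := potForm_constState_ne_top hL hw hint
  set ε₃ : ℝ≥0∞ := ε / 3 with hε₃def
  have hε₃0 : ε₃ ≠ 0 := (ENNReal.div_pos hε.ne' (by norm_num)).ne'
  have hε₃t : ε₃ ≠ ⊤ := (ENNReal.div_lt_top hεtop (by norm_num)).ne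
  have hε₃ε : ε₃ + ε₃ + ε₃ = ε := ENNReal.add_thirds ε
  rcases ht.eq_or_lt with rfl | htpos
  · -- CASE `t = 0` (the free anchor): `E_0[Ψ] ≤ E_{t'}[Ψ] ≤ E₀(t') + δ' ≤ t'·H + δ'`
    obtain ⟨n, hn0, hnH⟩ := ENNReal.exists_nnreal_pos_mul_lt hH hε₃0
    refine ⟨n, NNReal.coe_pos.2 hn0, ε₃, pos_iff_ne_zero.2 hε₃0, fun t' ht' hθ Ψ hΨ => ?_⟩
    rw [sub_zero] at hθ
    have ht'n : ENNReal.ofReal t' ≤ (n : ℝ≥0∞) := by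
      rw [← ENNReal.ofReal_coe_nnreal]
      exact ENNReal.ofReal_le_ofReal ((le_abs_self t').trans hθ.le)
    calc periodicEnergy (fun r => ENNReal.ofReal 0 * w r) Ψ
        ≤ periodicEnergy (fun r => ENNReal.ofReal t' * w r) Ψ := periodicEnergy_couplingPath_mono ht'.1 w Ψ
      _ ≤ periodicGroundStateEnergy (fun r => ENNReal.ofReal t' * w r) N L + ε₃ := hΨ
      _ ≤ ENNReal.ofReal t' * H + ε₃ := by
          gcongr
          exact periodicGroundStateEnergy_couplingPath_le_hartree hL t' w
      _ ≤ (n : ℝ≥0∞) * H + ε₃ := by gcongr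
      _ ≤ ε₃ + ε₃ := by gcongr
      _ ≤ ε₃ + ε₃ + ε₃ := le_self_add
      _ = ε := hε₃ε
      _ ≤ _ := le_add_self
  · -- CASE `t > 0`
    have ht2 : ENNReal.ofReal (t / 2) ≠ 0 := (ENNReal.ofReal_pos.2 (half_pos htpos)).ne'
    -- finiteness of `E₀(t)` and an `ε₃`-near-minimiser `Φ` at coupling `t`
    have hE₀ : periodicGroundStateEnergy (fun r => ENNReal.ofReal t * w r) N L ≠ ⊤ :=
      ne_top_of_le_ne_top (ENNReal.mul_ne_top ENNReal.ofReal_ne_top hH)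
        (periodicGroundStateEnergy_couplingPath_le_hartree hL t w)
    obtain ⟨Φ, hΦ⟩ : ∃ Φ : PeriodicTrialState N L, periodicEnergy (fun r => ENNReal.ofReal t * w r) Φ <
        periodicGroundStateEnergy (fun r => ENNReal.ofReal t * w r) N L + ε₃ :=
      iInf_lt_iff.1 (ENNReal.lt_add_right hE₀ hε₃0)
    -- the budget `B = H + ε₃/(t/2)` bounding `P_w[Φ]` and `P_w` of the near-minimisers at couplings `t' ≥ t/2`
    set B : ℝ≥0∞ := H + ε₃ / ENNReal.ofReal (t / 2) with hBdef
    have hB : B ≠ ⊤ := ENNReal.add_ne_top.2 ⟨hH, (ENNReal.div_lt_top hε₃t ht2).ne⟩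
    have hPΦ : potForm w L Φ.ψ ≤ B :=
      (potForm_le_of_nearMin hL htpos w Φ hΦ.le).trans
        (add_le_add le_rfl (ENNReal.div_le_div_left (ENNReal.ofReal_le_ofReal (by linarith)) _))
    obtain ⟨n, hn0, hnB⟩ := ENNReal.exists_nnreal_pos_mul_lt hB hε₃0
    refine ⟨min (t / 2) (n : ℝ), lt_min (half_pos htpos) (NNReal.coe_pos.2 hn0), ε₃, pos_iff_ne_zero.2 hε₃0,
      fun t' ht' hθ Ψ hΨ => ?_⟩
    obtain ⟨hθ1, hθ2⟩ := abs_sub_lt_iff.1 hθ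
    have hmin1 : min (t / 2) (n : ℝ) ≤ t / 2 := min_le_left _ _
    have hmin2 : min (t / 2) (n : ℝ) ≤ n := min_le_right _ _
    have ht'half : t / 2 ≤ t' := by linarith
    have ht'pos : 0 < t' := by linarith
    -- the small factor: `|s| < θ ≤ n` and `X ≤ B` give `|s| · X ≤ n · B ≤ ε₃`
    have hsmall : ∀ {X : ℝ≥0∞}, X ≤ B → ∀ {s : ℝ}, |s| < min (t / 2) (n : ℝ) →
        ENNReal.ofReal |s| * X ≤ ε₃ := by
      intro X hX s hs
      calc ENNReal.ofReal |s| * X ≤ (n : ℝ≥0∞) * B :=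
            mul_le_mul' (by rw [← ENNReal.ofReal_coe_nnreal]; exact ENNReal.ofReal_le_ofReal (hs.le.trans hmin2))
              hX
        _ ≤ ε₃ := hnB.le
    rcases le_or_gt t t' with htt' | htt'
    · -- `t ≤ t'`: monotonicity in `t`, then transport the near-minimiser `Φ` from `t` to `t'`
      calc periodicEnergy (fun r => ENNReal.ofReal t * w r) Ψ
          ≤ periodicEnergy (fun r => ENNReal.ofReal t' * w r) Ψ := periodicEnergy_couplingPath_mono htt' w Ψ
        _ ≤ periodicGroundStateEnergy (fun r => ENNReal.ofReal t' * w r) N L + ε₃ := hΨ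
        _ ≤ periodicEnergy (fun r => ENNReal.ofReal t' * w r) Φ + ε₃ := by
            gcongr
            exact periodicGroundStateEnergy_le _ Φ
        _ ≤ periodicEnergy (fun r => ENNReal.ofReal t * w r) Φ + ENNReal.ofReal |t' - t| * potForm w L Φ.ψ +
              ε₃ := by
            gcongr
            exact periodicEnergy_couplingPath_le_add t' t w Φ
        _ ≤ periodicGroundStateEnergy (fun r => ENNReal.ofReal t * w r) N L + ε₃ + ε₃ + ε₃ := by
            gcongr
            exact hsmall hPΦ hθ
        _ = periodicGroundStateEnergy (fun r => ENNReal.ofReal t * w r) N L + ε := by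
            rw [← hε₃ε]
            simp only [add_assoc]
    · -- `t' < t`: transport `Ψ` itself from `t'` to `t` (its `P_w` is under control since `t' ≥ t/2`),
      -- then monotonicity of `E₀`
      have hPΨ : potForm w L Ψ.ψ ≤ B :=
        (potForm_le_of_nearMin hL ht'pos w Ψ hΨ).trans
          (add_le_add le_rfl (ENNReal.div_le_div_left (ENNReal.ofReal_le_ofReal ht'half) _))
      have hθ' : |t - t'| < min (t / 2) (n : ℝ) := by rwa [abs_sub_comm] at hθ
      calc periodicEnergy (fun r => ENNReal.ofReal t * w r) Ψ
          ≤ periodicEnergy (fun r => ENNReal.ofReal t' * w r) Ψ + ENNReal.ofReal |t - t'| * potForm w L Ψ.ψ :=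
            periodicEnergy_couplingPath_le_add t t' w Ψ
        _ ≤ periodicGroundStateEnergy (fun r => ENNReal.ofReal t' * w r) N L + ε₃ + ε₃ := by
            gcongr
            exact hsmall hPΨ hθ'
        _ ≤ periodicGroundStateEnergy (fun r => ENNReal.ofReal t * w r) N L + ε₃ + ε₃ := by
            gcongr ?_ + _ + _
            exact periodicGroundStateEnergy_couplingPath_mono htt'.le w N L
        _ ≤ periodicGroundStateEnergy (fun r => ENNReal.ofReal t * w r) N L + (ε₃ + ε₃ + ε₃) := by
            rw [add_assoc]
            exact add_le_add le_rfl le_self_add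
        _ = _ := by rw [hε₃ε]

end PathTransport

/-- **Registered helper sub-goal `stub_fsumPathTransport`** (line `fsum-phase-pencil`, S5-C1): continuity of the
periodic `N`-body variational problem along the coupling path `t ↦ t·w` at fixed `(N, L)` — near-minimisers of
`H_(t')` are near-minimisers of `H_t` for `t'` close to `t` (`pathTransport_nearMin`). [folklore] -/
theorem stub_fsumPathTransport : (∀ {N : ℕ} {L : ℝ}, 0 < L → ∀ {w : ℝ → ℝ≥0∞}, Measurable w → (∫⁻ x : Space, w ‖x‖) ≠ ⊤ → ∀ t : ℝ, t ∈ Set.Icc (0 : ℝ) 1 → ∀ ε : ℝ≥0∞, 0 < ε → ∃ θ : ℝ, 0 < θ ∧ ∃ δ' : ℝ≥0∞, 0 < δ' ∧ ∀ t' : ℝ, t' ∈ Set.Icc (0 : ℝ) 1 → |t' - t| < θ → ∀ Ψ : PeriodicTrialState N L, periodicEnergy (fun r => ENNReal.ofReal t' * w r) Ψ ≤ periodicGroundStateEnergy (fun r => ENNReal.ofReal t' * w r) N L + δ' → periodicEnergy (fun r => ENNReal.ofReal t * w r) Ψ ≤ periodicGroundStateEnergy (fun r => ENNReal.ofReal t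 * w r) N L + ε) :=
  fun hL _ hw hint _ ht _ hε => pathTransport_nearMin hL hw hint ht.1 hε

end Summit.AtomisticToContinuum.BoseEinsteinCondensation.Cruxes.PeriodicIRBound.FsumPhasePencil

end
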